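import Summits.AnomalousDissipation.AnomalousDissipation.Theorems.BaireTransferRobustLoudUpgradeLine
import Literature.Analysis.FluidPDE.LinearizedNSTorus
import Literature.Analysis.FunctionSpaces.TorusClassicalNSGluing
import Literature.Analysis.FunctionSpaces.TorusFourierCalculus
import Literature.Analysis.FunctionSpaces.TorusInverseLaplacianCalculus
import Literature.Analysis.FunctionSpaces.TorusCalculusProofs
import Literature.Analysis.FunctionSpaces.TorusSpaceTime

/-!
# Sub-goal `velocityDot_mem_linPeriodicSol` of the line `malkin-cone-group-orbits`
# (crux stmt-AnomalousDissipation-1144, `BaireTransfer.RobustLoudUpgrade`): consistency of the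
# periodic vocabulary `linPeriodicSol` / `velocityDot` / `nondegPeriodic`

The class `nondegPeriodic` of the line states nondegeneracy of a `τ`-periodic classical witness `u`
of `NS_ν(f_c)` through the classical linearised periodic problem `linPeriodicSol ν u τ g`
(`∂ₜw = L(ν,u(t))w − ∇q + g`, `w` jointly smooth, divergence free, mean zero, `τ`-periodic) and the
complexified acceleration `velocityDot u = ∂ₜu`: (i) `linPeriodicSol ν u τ 0 ⊆ ℂ • velocityDot u`,
(ii) `linPeriodicSol ν u τ (velocityDot u) = ∅`.  This file certifies that the class is not
misstated: for EVERY periodic classical witness of a steady mean-zero force,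
`velocityDot u ∈ linPeriodicSol ν u τ 0` with the pressure `∂ₜp` — the momentum equation
differentiated in time (`timeDerivWithin_acceleration`:
`∂ₜ(∂ₜu) = νΔ∂ₜu − ((∂ₜu·∇)u + (u·∇)∂ₜu) − ∇∂ₜp`) and complexified — so the sign conventions of
`Torus.linearizedNSOperator` (`L(ν,u_S)(w,q) = νΔw − [(u_S·∇)w + (w·∇)u_S] − ∇q`), the
complexification `Torus.realToComplex` and the two-sided `Torus.timeDerivWithin univ` in
`linPeriodicSol` are the intended ones (clause (i) is satisfiable and sharp); and a steady field is
never a `nondegPeriodic` witness (`velocityDot u = 0 ∈ linPeriodicSol ν u τ 0`, so clause (ii) fails: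
`linPeriodicSol_velocityDot_nonempty_of_steady`) — steady witnesses belong to the steady classes.

References: D. Henry, *Geometric Theory of Semilinear Parabolic Equations*, LNM 840 (1981), Ch. 8
(the derivative of a periodic orbit is a `1`-eigenvector of the period map); the vocabulary module
`Theorems/BaireTransferRobustLoudUpgradeLine.lean` §3; calculus from
`Literature/Analysis/FunctionSpaces/TorusInverseLaplacianCalculus.lean` (`timeDerivWithin_*_comm`).
-/

-- `Summit.<Summit>.<Problem>` is the tree's mandated summit-side namespace (CONVENTIONS §2); for this
-- single-conjunct summit the two coincide, so the duplicate is deliberate.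
set_option linter.dupNamespace false

noncomputable section

open scoped BigOperators Topology
open Filter Set Function TopologicalSpace MeasureTheory

namespace Summit.AnomalousDissipation.AnomalousDissipation.Theorems.RobustLoudUpgrade.LinPeriodicSolBasics

open Literature.Analysis.FunctionSpaces Literature.Analysis.FunctionSpaces.Torus
open Literature.Analysis.FluidPDE

section Consistency

variable {F : Type*} [NormedAddCommGroup F] [NormedSpace ℝ F]

/-- `∂ₜ∂ⱼ = ∂ⱼ∂ₜ` for jointly smooth fields on `ℝ × T³` (from the tree's `[a,b]` version). [folklore] -/
theorem timeDerivWithin_univ_partialDeriv_comm {v : ℝ → UnitAddTorus (Fin 3) → F}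
    (hv : Torus.IsSmoothSpaceTimeOn univ v)
    (t : ℝ) (j : Fin 3) (x : UnitAddTorus (Fin 3)) :
    Torus.timeDerivWithin univ (fun s => partialDeriv j (v s)) t x =
      partialDeriv j (Torus.timeDerivWithin univ v t) x := by
  have hab : t - 1 < t + 1 := by linarith
  have htI : t ∈ Icc (t - 1) (t + 1) := ⟨by linarith, by linarith⟩
  have hvI : Torus.IsSmoothSpaceTimeOn (Icc (t - 1) (t + 1)) v := hv.mono (subset_univ _)
  have e1 := (hv.partialDeriv uniqueDiffOn_univ j).timeDerivWithin_eq_of_subset (subset_univ _)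
    (uniqueDiffOn_Icc hab) htI x
  have e2 : Torus.timeDerivWithin (Icc (t - 1) (t + 1)) v t = Torus.timeDerivWithin univ v t :=
    funext fun y => hv.timeDerivWithin_eq_of_subset (subset_univ _) (uniqueDiffOn_Icc hab) htI y
  rw [← e1, timeDerivWithin_partialDeriv_comm hab hvI htI j x, e2]

/-- `∂ₜΔ = Δ∂ₜ` for jointly smooth fields on `ℝ × T³`. [folklore] -/
theorem timeDerivWithin_univ_laplacian_comm {v : ℝ → UnitAddTorus (Fin 3) → F} (hv : Torus.IsSmoothSpaceTimeOn univ v)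
    (t : ℝ) (x : UnitAddTorus (Fin 3)) :
    Torus.timeDerivWithin univ (fun s => laplacian (v s)) t x = laplacian (Torus.timeDerivWithin univ v t) x := by
  have hab : t - 1 < t + 1 := by linarith
  have htI : t ∈ Icc (t - 1) (t + 1) := ⟨by linarith, by linarith⟩
  have hvI : Torus.IsSmoothSpaceTimeOn (Icc (t - 1) (t + 1)) v := hv.mono (subset_univ _)
  have e1 := (hv.laplacian uniqueDiffOn_univ).timeDerivWithin_eq_of_subset (subset_univ _)
    (uniqueDiffOn_Icc hab) htI x
  have e2 : Torus.timeDerivWithin (Icc (t - 1) (t + 1)) v t = Torus.timeDerivWithin univ v t :=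
    funext fun y => hv.timeDerivWithin_eq_of_subset (subset_univ _) (uniqueDiffOn_Icc hab) htI y
  rw [← e1, timeDerivWithin_laplacian_comm hab hvI htI x, e2]

/-- Coordinates of the torus gradient (`C¹` scalars). [folklore] -/
theorem gradient_apply' {θ : UnitAddTorus (Fin 3) → ℝ} (hθ : IsContDiff 1 θ) (x : UnitAddTorus (Fin 3)) (j : Fin 3) :
    Torus.gradient θ x j = partialDeriv j θ x := by
  rw [gradient_eq_sum_partialDeriv hθ]
  simp [Finset.sum_apply, Pi.single_apply]

/-- `∂ₜ∇ = ∇∂ₜ` for jointly smooth scalars on `ℝ × T³`. [folklore] -/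
theorem timeDerivWithin_univ_gradient_comm {θ : ℝ → UnitAddTorus (Fin 3) → ℝ} (hθ : Torus.IsSmoothSpaceTimeOn univ θ)
    (t : ℝ) (x : UnitAddTorus (Fin 3)) :
    Torus.timeDerivWithin univ (fun s => gradient (θ s)) t x = gradient (Torus.timeDerivWithin univ θ t) x := by
  have h1 : ∀ s, IsContDiff 1 (θ s) := fun s => (hθ.isSmooth_slice (mem_univ s)).isContDiff (by simp)
  have hd1 : IsContDiff 1 (Torus.timeDerivWithin univ θ t) :=
    ((hθ.timeDerivWithin uniqueDiffOn_univ).isSmooth_slice (mem_univ t)).isContDiff (by simp)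
  have e : (fun s => gradient (θ s)) =
      fun s y => ∑ i, partialDeriv i (θ s) y • EuclideanSpace.single i (1 : ℝ) := by
    funext s y
    exact gradient_eq_sum_partialDeriv (h1 s) y
  rw [e, timeDerivWithin_finset_sum Finset.univ
      (fun i _ => (hθ.partialDeriv uniqueDiffOn_univ i).smul (isSmoothSpaceTimeOn_const (isSmooth_const _) _))
      uniqueDiffOn_univ (mem_univ t) x,
    gradient_eq_sum_partialDeriv hd1 x]
  refine Finset.sum_congr rfl fun i _ => ?_
  have hder := (((hθ.partialDeriv uniqueDiffOn_univ i).hasDerivWithinAt_slice (mem_univ t) x).smul_const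
    (EuclideanSpace.single i (1 : ℝ))).derivWithin (uniqueDiffWithinAt_univ (𝕜 := ℝ) (x := t))
  unfold Torus.timeDerivWithin at hder ⊢
  rw [hder]
  congr 1
  exact timeDerivWithin_univ_partialDeriv_comm hθ t i x

variable {ν τ : ℝ} {f : UnitAddTorus (Fin 3) → EuclideanSpace ℝ (Fin 3)}
  {u : ℝ → UnitAddTorus (Fin 3) → EuclideanSpace ℝ (Fin 3)} {p : ℝ → UnitAddTorus (Fin 3) → ℝ}

/-- **The momentum equation differentiated in time** (real form): for a classical solution of
`NS_ν(f)` with steady force on `ℝ × T³`, the acceleration `A = ∂ₜu` solves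
`∂ₜA = νΔA − ((A·∇)u + (u·∇)A) − ∇∂ₜp`. [folklore] -/
theorem timeDerivWithin_acceleration (hsol : IsClassicalNSSolutionOn univ ν (fun _ => f) u p)
    (t : ℝ) (x : UnitAddTorus (Fin 3)) :
    Torus.timeDerivWithin univ (Torus.timeDerivWithin univ u) t x =
      ν • laplacian (Torus.timeDerivWithin univ u t) x -
        (Torus.convect (Torus.timeDerivWithin univ u t) (u t) x +
          Torus.convect (u t) (Torus.timeDerivWithin univ u t) x) -
        gradient (Torus.timeDerivWithin univ p t) x := by
  have hu := hsol.smooth_velocity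
  have hp := hsol.smooth_pressure
  have hAs : Torus.IsSmoothSpaceTimeOn univ (Torus.timeDerivWithin univ u) := hu.timeDerivWithin uniqueDiffOn_univ
  have hu1 : ∀ s, IsContDiff 1 (u s) := fun s => (hu.isSmooth_slice (mem_univ s)).isContDiff (by simp)
  have hA1 : IsContDiff 1 (Torus.timeDerivWithin univ u t) :=
    (hAs.isSmooth_slice (mem_univ t)).isContDiff (by simp)
  -- the momentum equation solved for `∂ₜu`, as an identity between functions of time
  have hmom : (fun s => Torus.timeDerivWithin univ u s x) = fun s =>
      ν • laplacian (u s) x - gradient (p s) x + f x - Torus.convect (u s) (u s) x := by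
    funext s
    exact eq_sub_of_add_eq (hsol.momentum s (mem_univ s) x)
  -- derivatives of the four terms
  have dL : HasDerivWithinAt (fun s => laplacian (u s) x) (laplacian (Torus.timeDerivWithin univ u t) x) univ t := by
    have h := (hu.laplacian uniqueDiffOn_univ).hasDerivWithinAt_slice (mem_univ t) x
    rwa [timeDerivWithin_univ_laplacian_comm hu t x] at h
  have dP : HasDerivWithinAt (fun s => gradient (p s) x) (gradient (Torus.timeDerivWithin univ p t) x) univ t := by
    have h := (hp.gradient uniqueDiffOn_univ).hasDerivWithinAt_slice (mem_univ t) x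
    rwa [timeDerivWithin_univ_gradient_comm hp t x] at h
  have dF : HasDerivWithinAt (fun _ : ℝ => f x) 0 univ t := hasDerivWithinAt_const _ _ _
  have dC : HasDerivWithinAt (fun s => Torus.convect (u s) (u s) x)
      (Torus.convect (Torus.timeDerivWithin univ u t) (u t) x +
        Torus.convect (u t) (Torus.timeDerivWithin univ u t) x) univ t := by
    have e : (fun s => Torus.convect (u s) (u s) x) = fun s => ∑ i, (u s x) i • partialDeriv i (u s) x := by
      funext s
      exact fderiv_apply_eq_sum_partialDeriv (hu1 s) x (u s x)
    rw [e]
    have hcoord : ∀ i, HasDerivWithinAt (fun s => (u s x) i) ((Torus.timeDerivWithin univ u t x) i) univ t := by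
      intro i
      have h := (hu.apply i).hasDerivWithinAt_slice (mem_univ t) x
      exact h.congr_deriv (timeDerivWithin_clm_comp hu uniqueDiffOn_univ (EuclideanSpace.proj i) (mem_univ t) x)
    have hpd : ∀ i, HasDerivWithinAt (fun s => partialDeriv i (u s) x)
        (partialDeriv i (Torus.timeDerivWithin univ u t) x) univ t := by
      intro i
      have h := (hu.partialDeriv uniqueDiffOn_univ i).hasDerivWithinAt_slice (mem_univ t) x
      rwa [timeDerivWithin_univ_partialDeriv_comm hu t i x] at h
    have hsum := HasDerivWithinAt.fun_sum (u := Finset.univ) fun i _ => (hcoord i).fun_smul (hpd i)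
    refine hsum.congr_deriv ?_
    change _ = Torus.fderiv (u t) x (Torus.timeDerivWithin univ u t x) +
        Torus.fderiv (Torus.timeDerivWithin univ u t) x (u t x)
    rw [fderiv_apply_eq_sum_partialDeriv (hu1 t), fderiv_apply_eq_sum_partialDeriv hA1,
      ← Finset.sum_add_distrib]
    refine Finset.sum_congr rfl fun i _ => ?_
    rw [add_comm]
  have hfull := (((dL.fun_const_smul ν).fun_sub dP).fun_add dF).fun_sub dC
  change derivWithin (fun s => Torus.timeDerivWithin univ u s x) univ t = _
  rw [hmom, hfull.derivWithin (uniqueDiffWithinAt_univ (𝕜 := ℝ) (x := t))]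
  abel

/-- **`∂ₜu` (complexified) solves the linearised periodic problem**: for every `τ`-periodic classical
solution of `NS_ν(f)` on `ℝ × T³` with a steady mean-zero force, `velocityDot u ∈ linPeriodicSol ν u τ 0`
with the pressure `∂ₜp` — the time derivative of the momentum equation, complexified.  (So clause (i) of
`nondegPeriodic` is consistent, and clause (ii) excludes exactly the Jordan partners of `∂ₜu`; a steady
state, where `velocityDot u = 0 ∈ linPeriodicSol ν u τ 0 = linPeriodicSol ν u τ (velocityDot u)`, is never
in `nondegPeriodic`.) [folklore] -/
theorem velocityDot_mem_linPeriodicSol_of (hsol : IsClassicalNSSolutionOn univ ν (fun _ => f) u p)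
    (hper : Function.Periodic u τ) (hf : HasZeroMean f) : velocityDot u ∈ linPeriodicSol ν u τ 0 := by
  have hu := hsol.smooth_velocity
  have hp := hsol.smooth_pressure
  set L : EuclideanSpace ℝ (Fin 3) →L[ℝ] EuclideanSpace ℂ (Fin 3) :=
    EuclideanSpace.complexify.toContinuousLinearMap with hL
  have hAs : Torus.IsSmoothSpaceTimeOn univ (Torus.timeDerivWithin univ u) := hu.timeDerivWithin uniqueDiffOn_univ
  have hAt : ∀ t, IsSmooth (Torus.timeDerivWithin univ u t) := fun t => hAs.isSmooth_slice (mem_univ t)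
  have hvd : velocityDot u = fun t x => L (Torus.timeDerivWithin univ u t x) := rfl
  refine ⟨?_, ?_, ?_, ?_, ?_⟩
  · -- jointly smooth
    rw [hvd]
    exact hAs.clm_comp L
  · -- divergence free: `div ∂ₜu = ∂ₜ div u = 0`
    intro t y
    have hdivA : Torus.divergence (Torus.timeDerivWithin univ u t) y = 0 := by
      unfold Torus.divergence
      have e1 : ∀ i, partialDeriv i (fun z => Torus.timeDerivWithin univ u t z i) y =
          Torus.timeDerivWithin univ (fun s => partialDeriv i (fun z => u s z i)) t y := by
        intro i
        have e : (fun z => Torus.timeDerivWithin univ u t z i) = Torus.timeDerivWithin univ (fun s z => u s z i) t := by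
          funext z
          exact (timeDerivWithin_clm_comp hu uniqueDiffOn_univ (EuclideanSpace.proj i) (mem_univ t) z).symm
        rw [e, timeDerivWithin_univ_partialDeriv_comm (hu.apply i) t i y]
      simp_rw [e1]
      rw [← timeDerivWithin_finset_sum Finset.univ (fun i _ => (hu.apply i).partialDeriv uniqueDiffOn_univ i)
        uniqueDiffOn_univ (mem_univ t) y]
      have e2 : (fun s (z : UnitAddTorus (Fin 3)) => ∑ i, partialDeriv i (fun w => u s w i) z) =
          fun _ _ => (0 : ℝ) := by
        funext s z
        exact hsol.divFree s (mem_univ s) z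
      rw [e2]
      simp [Torus.timeDerivWithin]
    unfold Torus.divergenceC
    have e3 : ∀ i, partialDeriv i (fun z => velocityDot u t z i) y =
        Complex.ofRealCLM (partialDeriv i (fun z => Torus.timeDerivWithin univ u t z i) y) := by
      intro i
      have e : (fun z => velocityDot u t z i) = Complex.ofRealCLM ∘ fun z => Torus.timeDerivWithin univ u t z i := by
        funext z
        simp [velocityDot]
      rw [e]
      exact partialDeriv_clm_comp ((hAs.apply i).isSmooth_slice (mem_univ t)) Complex.ofRealCLM i y
    simp_rw [e3]
    rw [← map_sum]
    unfold Torus.divergence at hdivA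
    rw [hdivA, map_zero]
  · -- mean zero: `∫ ∂ₜu = d/dt ∫ u = ∫ f = 0`
    intro t
    unfold HasZeroMean
    rw [hvd]
    change ∫ y, L (Torus.timeDerivWithin univ u t y) = 0
    rw [ContinuousLinearMap.integral_comp_comm L (hAt t).integrable]
    have h1 := (hu.hasDerivWithinAt_integral convex_univ (mem_univ t)).derivWithin
      (uniqueDiffWithinAt_univ (𝕜 := ℝ) (x := t))
    have h2 := (hsol.hasDerivWithinAt_integral_velocity convex_univ (mem_univ t)).derivWithin
      (uniqueDiffWithinAt_univ (𝕜 := ℝ) (x := t))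
    rw [h1] at h2
    rw [h2]
    change L (∫ y, f y) = 0
    rw [hf, map_zero]
  · -- periodic
    intro t
    funext y
    simp only [velocityDot]
    congr 1
    unfold Torus.timeDerivWithin
    simp only [derivWithin_univ]
    have e : (fun s => u s y) = fun s => u (s + τ) y := by
      funext s
      rw [hper s]
    calc deriv (fun s => u s y) (t + τ) = deriv (fun s => u (s + τ) y) t := by
          rw [deriv_comp_add_const (fun s => u s y) τ t]
      _ = deriv (fun s => u s y) t := by rw [← e]
  · -- the equation, with pressure `∂ₜp`
    refine ⟨fun t y => ((Torus.timeDerivWithin univ p t y : ℝ) : ℂ), ?_, fun t y => ?_⟩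
    · have h := (hp.timeDerivWithin uniqueDiffOn_univ).clm_comp Complex.ofRealCLM
      simpa using h
    rw [Pi.zero_apply, Pi.zero_apply, add_zero, hvd,
      timeDerivWithin_clm_comp hAs uniqueDiffOn_univ L (mem_univ t) y, timeDerivWithin_acceleration hsol t y,
      Torus.linearizedNSOperator_apply]
    -- the four terms, complexified
    have hA1 : IsContDiff 1 (Torus.timeDerivWithin univ u t) := (hAt t).isContDiff (by simp)
    have hu1 : IsContDiff 1 (u t) := (hu.isSmooth_slice (mem_univ t)).isContDiff (by simp)
    have hLA1 : IsContDiff 1 (L ∘ Torus.timeDerivWithin univ u t) := ((hAt t).comp_clm L).isContDiff (by simp)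
    have tL : laplacian (fun x => L (Torus.timeDerivWithin univ u t x)) y =
        L (laplacian (Torus.timeDerivWithin univ u t) y) :=
      laplacian_clm_comp_apply (hAt t) L y
    have tC : Torus.convect (u t) (fun x => L (Torus.timeDerivWithin univ u t x)) y =
        L (Torus.convect (u t) (Torus.timeDerivWithin univ u t) y) := by
      change Torus.fderiv (L ∘ Torus.timeDerivWithin univ u t) y (u t y) =
        L (Torus.fderiv (Torus.timeDerivWithin univ u t) y (u t y))
      rw [fderiv_apply_eq_sum_partialDeriv hLA1, fderiv_apply_eq_sum_partialDeriv hA1, map_sum]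
      refine Finset.sum_congr rfl fun i _ => ?_
      rw [partialDeriv_clm_comp (hAt t) L i y, L.map_smul]
    have tS : Torus.stretch (fun x => L (Torus.timeDerivWithin univ u t x)) (u t) y =
        L (Torus.convect (Torus.timeDerivWithin univ u t) (u t) y) := by
      change (∑ j, L (Torus.timeDerivWithin univ u t y) j • Torus.realToComplex (partialDeriv j (u t) y)) =
        L (Torus.fderiv (u t) y (Torus.timeDerivWithin univ u t y))
      rw [fderiv_apply_eq_sum_partialDeriv hu1, map_sum]
      refine Finset.sum_congr rfl fun j _ => ?_
      rw [L.map_smul]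
      change ((Torus.timeDerivWithin univ u t y j : ℝ) : ℂ) • L (partialDeriv j (u t) y) =
        (Torus.timeDerivWithin univ u t y j) • L (partialDeriv j (u t) y)
      exact (RCLike.real_smul_eq_coe_smul (K := ℂ) _ _).symm
    have tP : Torus.gradientC (fun x => ((Torus.timeDerivWithin univ p t x : ℝ) : ℂ)) y =
        L (gradient (Torus.timeDerivWithin univ p t) y) := by
      have hq1 : IsSmooth (Torus.timeDerivWithin univ p t) :=
        (hp.timeDerivWithin uniqueDiffOn_univ).isSmooth_slice (mem_univ t)
      ext i
      change partialDeriv i (Complex.ofRealCLM ∘ Torus.timeDerivWithin univ p t) y =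
        ((gradient (Torus.timeDerivWithin univ p t) y i : ℝ) : ℂ)
      rw [partialDeriv_clm_comp hq1 Complex.ofRealCLM i y, gradient_apply' (hq1.isContDiff (by simp)) y i]
      rfl
    rw [tL, tC, tS, tP, map_sub, map_sub, map_add, L.map_smul, add_comm (L _) (L _)]

/-- The zero field solves the homogeneous linearised periodic problem (pressure `0`). [folklore] -/
theorem zero_mem_linPeriodicSol (ν : ℝ) (u : ℝ → UnitAddTorus (Fin 3) → EuclideanSpace ℝ (Fin 3)) (τ : ℝ) :
    (0 : ℝ → UnitAddTorus (Fin 3) → EuclideanSpace ℂ (Fin 3)) ∈ linPeriodicSol ν u τ 0 := by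
  refine ⟨isSmoothSpaceTimeOn_const (isSmooth_const _) _, fun _ => Torus.isDivFreeC_zero,
    fun _ => by simp [HasZeroMean], fun _ => rfl, 0, isSmoothSpaceTimeOn_const (isSmooth_const _) _,
    fun t x => ?_⟩
  have h1 : Torus.timeDerivWithin univ (0 : ℝ → UnitAddTorus (Fin 3) → EuclideanSpace ℂ (Fin 3)) t x = 0 := by
    change derivWithin (fun _ : ℝ => (0 : EuclideanSpace ℂ (Fin 3))) univ t = 0
    simp
  rw [h1]
  simp only [Pi.zero_apply, add_zero, Torus.linearizedNSOperator_zero]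

/-- **A steady field is never a `nondegPeriodic` witness**: for `u` constant in time `velocityDot u = 0`,
and `0 ∈ linPeriodicSol ν u τ 0 = linPeriodicSol ν u τ (velocityDot u)`, so clause (ii) of `nondegPeriodic`
(`linPeriodicSol ν u τ (velocityDot u) = ∅`) fails — steady witnesses belong to the steady classes. [folklore] -/
theorem linPeriodicSol_velocityDot_nonempty_of_steady (ν : ℝ)
    (u₀ : UnitAddTorus (Fin 3) → EuclideanSpace ℝ (Fin 3)) (τ : ℝ) :
    linPeriodicSol ν (fun _ : ℝ => u₀) τ (velocityDot fun _ : ℝ => u₀) ≠ ∅ := by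
  have h0 : velocityDot (fun _ : ℝ => u₀) = 0 := by
    funext t x
    simp [velocityDot, Torus.timeDerivWithin]
  rw [h0, ← Set.nonempty_iff_ne_empty]
  exact ⟨0, zero_mem_linPeriodicSol ν _ τ⟩

end Consistency

/-! ## The registered sub-goal (Pi form) -/

/-- **`∂ₜu ∈ linPeriodicSol ν u τ 0`** for every `τ`-periodic classical solution of `NS_ν(f)` on
`ℝ × T³` with a steady mean-zero force (registered sub-goal `velocityDot_mem_linPeriodicSol` of the
line `malkin-cone-group-orbits`; Pi form of `velocityDot_mem_linPeriodicSol_of`). [folklore] -/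
theorem velocityDot_mem_linPeriodicSol : ∀ (ν τ : ℝ) (f : UnitAddTorus (Fin 3) → EuclideanSpace ℝ (Fin 3)) (u : ℝ → UnitAddTorus (Fin 3) → EuclideanSpace ℝ (Fin 3)) (p : ℝ → UnitAddTorus (Fin 3) → ℝ), IsClassicalNSSolutionOn Set.univ ν (fun _ => f) u p → Function.Periodic u τ → HasZeroMean f → velocityDot u ∈ linPeriodicSol ν u τ 0 :=
  fun _ _ _ _ _ hsol hper hf => velocityDot_mem_linPeriodicSol_of hsol hper hf

end Summit.AnomalousDissipation.AnomalousDissipation.Theorems.RobustLoudUpgrade.LinPeriodicSolBasics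

end
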